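import Literature.AlgebraicGeometry.Motives.HodgeThetaSubalgebraUnitaryNineElevenCore
import HarnessLib

/-!
# The `Θ`-subalgebra theorem for unitary multiplicities `(13, b)`, EVERY `b` prime to `13`, and `(12, 13)` —
# complex–Hermitian, classification-free (Ribet 1983 Thm. 3, Lie step)

Family `hodge`, layer `Literature/AlgebraicGeometry/Motives` (pure linear algebra over `ℂ`; no geometry). Research
context: cell `pub-hodge-ring2` (HONEST FRAMING: research route conditional on HC_CM; not a corollary; Q11.4-sentence-2
already refuted in dim ≥ 3), Literature lane gen 84, programme R69. UNCONDITIONAL; theorems only, no definition, no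
named fact (D-0026), no `sorry`.

As for `a = 11` (`HodgeThetaSubalgebraUnitaryNineElevenCore`): `a = dim P = 13` prime ⟹ every intermediate rank is
raised by the Ψ-core route with a Levi core of type `(13 − r | r)` (all in the tree), the top rank by the triple route
(never obstructed for coprime pairs), and the Euclid descent `b → b − 13` needs the bases `(13 | c)`, `c ≤ 12`, of which
`(13 | 12)` is supplied here (§1) and the others by the tree's `(c | ·)` cores mirrored.

* §1 **`UnitaryTwelve.exists_raise_onto_twelve_thirteen`**, **`UnitaryTwelve.eq_top_thirteen`** (`(12 | 13)`),
  `eq_top_thirteen'` (`(13 | 12)`). HONEST SCOPE: general `(12 | b)` is not attempted (`(12 | 17)` needs `(8 | 9)`,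
  `(12 | 19)` needs `(9 | 10)`, `(12 | 25)` stalls at rank `10`).
* §2 **`UnitaryThirteen.exists_raise_onto_thirteen_of_smul`** (`dim Q ≥ 14`, `13 ∤ dim Q`),
  **`UnitaryThirteen.eq_top_of_smul`** — THE `(13 | b)` CORE FOR EVERY `b` WITH `13 ∤ b` — and its mirror.

## References
* [Ribet1983] K. A. Ribet, *Hodge classes on certain types of abelian varieties*, Amer. J. Math. 105 (1983), Thm. 3
  (= [Gordon1997, Thm. 6.3 (3)], held `paper:arxiv-alg-geom_9709030` pp. 18–19).
* [Deligne1982HodgeCycles] P. Deligne, *Hodge cycles on abelian varieties*, LNM 900 (1982), I §3 Prop. 3.4, 3.6.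
* [GoodmanWallachGTM255] R. Goodman, N. R. Wallach, GTM 255 (2009), §4.1.1, §3.3.2.
-/

noncomputable section

namespace Literature.AlgebraicGeometry.Motives

namespace HodgeStructure

/-! ### §1 Multiplicities `(12, 13)` -/

section Twelve

universe u

variable {W : Type u} [AddCommGroup W] [Module ℂ W]

/-- **The rank-twelve raising lemma at `dim Q = 13`** (`dim P = 12`): ranks `2, 3, 4, 6, 8, 9, 10 → +1` by the Φ-route
with the cores `(2|11), (3|10), (4|9), (6|7), (8|5), (9|4), (10|3)`, ranks `5, 7 → +1` by the Ψ-core route with the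
cores `(7|5), (5|7)`, rank `11 → 12` by the triple route (`2 (12 − ρ) = 11 ρ` has no solution).
[cite: Ribet1983, Thm. 3] [cite: Gordon1997, Thm. 6.3 (3)] [cite: Deligne1982HodgeCycles, I §3 Prop. 3.6] -/
theorem UnitaryTwelve.exists_raise_onto_twelve_thirteen [FiniteDimensional ℂ W] {𝔊 : Submodule ℂ (Module.End ℂ W)}
    (hbr : ∀ Y ∈ 𝔊, ∀ Z ∈ 𝔊, Y * Z - Z * Y ∈ 𝔊)
    (hirr : ∀ U : Submodule ℂ W, (∀ A ∈ 𝔊, ∀ u ∈ U, A u ∈ U) → U = ⊥ ∨ U = ⊤)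
    {Θ : Module.End ℂ W} (hΘ : Θ ∈ 𝔊) (hΘΘ : Θ * Θ = 1)
    {P Q : Submodule ℂ W} (hP : ∀ x, x ∈ P ↔ Θ x = x) (hQ : ∀ x, x ∈ Q ↔ Θ x = -x)
    (hP12 : Module.finrank ℂ P = 12) (hQ13 : Module.finrank ℂ Q = 13)
    {s : W → W → ℂ} (hadd : ∀ x y z, s (x + y) z = s x z + s y z)
    (hsmul : ∀ (c : ℂ) (x y : W), s (c • x) y = c * s x y) (hsymm : ∀ x y, s y x = starRingEnd ℂ (s x y))
    (hPQ : ∀ p ∈ P, ∀ q ∈ Q, s p q = 0) (hdefP : ∀ p ∈ P, s p p = 0 → p = 0) (hdefQ : ∀ q ∈ Q, s q q = 0 → q = 0)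
    (hadj : ∀ X ∈ 𝔊, ∃ Y ∈ 𝔊, ∀ x y, s (X x) y = s x (Y y)) :
    ∃ B ∈ 𝔊, Θ * B = B ∧ B * Θ = -B ∧ ∀ p ∈ P, ∃ w, B w = p := by
  classical
  refine UnitaryLadder.exists_raise_onto_of_hup hbr hirr hΘ hΘΘ hP hQ hP12 (by norm_num) (by omega) ?_
  intro B' hB' hΘB' hB'Θ h2 h11
  by_cases hr11 : Module.finrank ℂ (LinearMap.range B') = 11
  · -- triple route: `2 (12 − ρ) = 11 ρ` has no solution
    refine UnitaryRaisingRank.exists_raise_rank_gt_of_finrank_eq_succ_of_smul hbr hirr hΘ hΘΘ hP hQ hB' hΘB' hB'Θ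
      (by omega) (by rw [hr11, hP12]) (by omega) (fun ρ hρ1 hρr => ?_) hadd hsmul hsymm hPQ hdefP hdefQ hadj
    rw [hr11] at hρr ⊢
    rw [hQ13]
    interval_cases ρ <;> omega
  by_cases hr57 : Module.finrank ℂ (LinearMap.range B') = 5 ∨ Module.finrank ℂ (LinearMap.range B') = 7
  · -- Ψ-core route with the cores `(7|5)`, `(5|7)`
    refine UnitaryRaisingRank.exists_raise_rank_gt_of_psi_core hbr hirr hΘ hΘΘ hP hQ hB' hΘB' hB'Θ (by omega)
      (by omega) (by omega) hadd hsymm hPQ hdefP hdefQ hadj fun U 𝔩 ι P' Q' hbr𝔩 hirr𝔩 hι hιι hP' hQ' hfinP' hfinQ'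
        hP'Q' hdefP' hdefQ' hadj𝔩 => ?_
    rcases hr57 with hr5 | hr7
    · exact UnitarySeven.eq_top_of_smul hbr𝔩 hirr𝔩 hι hιι hP' hQ' (by omega) (by rw [hfinQ', hr5]; omega)
        (s := fun x y : U => s (x : W) y) (fun x y z => by simp only [Submodule.coe_add, hadd])
        (fun c x y => by simp only [Submodule.coe_smul, hsmul]) (fun x y => hsymm x y) hP'Q' hdefP' hdefQ' hadj𝔩
    · exact UnitaryFive.eq_top_of_smul hbr𝔩 hirr𝔩 hι hιι hP' hQ' (by omega) (by rw [hfinQ', hr7]; omega)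
        (s := fun x y : U => s (x : W) y) (fun x y z => by simp only [Submodule.coe_add, hadd])
        (fun c x y => by simp only [Submodule.coe_smul, hsmul]) (fun x y => hsymm x y) hP'Q' hdefP' hdefQ' hadj𝔩
  · -- Φ-route with the cores `(2|11), (3|10), (4|9), (6|7), (8|5), (9|4), (10|3)`
    push Not at hr57
    refine UnitaryRaisingRank.exists_raise_rank_gt_of_two_le hbr hirr hΘ hΘΘ hP hQ hadd hsymm hPQ hdefP hdefQ
      hadj hB' hΘB' hB'Θ (by omega) (by omega) (by omega) fun U 𝔩 ι P' Q' hbr𝔩 hirr𝔩 hι hιι hP' hQ' hfinP' hfinQ'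
        hP'Q' hdefP' hdefQ' hadj𝔩 => ?_
    rw [hQ13] at hfinQ'
    by_cases hr2 : Module.finrank ℂ (LinearMap.range B') = 2
    · exact UnitaryTwoOdd.eq_top hbr𝔩 hirr𝔩 hι hιι hP' hQ' (by rw [hfinP', hr2]) ⟨5, by omega⟩
        (s := fun x y : U => s (x : W) y) (fun x y z => by simp only [Submodule.coe_add, hadd])
        (fun x y => hsymm x y) hP'Q' hdefP' hdefQ' hadj𝔩
    by_cases hr3 : Module.finrank ℂ (LinearMap.range B') = 3
    · exact UnitaryThreeCoprime.eq_top hbr𝔩 hirr𝔩 hι hιι hP' hQ' (by rw [hfinP', hr3]) (by omega)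
        (s := fun x y : U => s (x : W) y) (fun x y z => by simp only [Submodule.coe_add, hadd])
        (fun x y => hsymm x y) hP'Q' hdefP' hdefQ' hadj𝔩
    by_cases hr4 : Module.finrank ℂ (LinearMap.range B') = 4
    · exact UnitaryFourOdd.eq_top hbr𝔩 hirr𝔩 hι hιι hP' hQ' (by rw [hfinP', hr4]) ⟨4, by omega⟩
        (s := fun x y : U => s (x : W) y) (fun x y z => by simp only [Submodule.coe_add, hadd])
        (fun x y => hsymm x y) hP'Q' hdefP' hdefQ' hadj𝔩
    by_cases hr6 : Module.finrank ℂ (LinearMap.range B') = 6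
    · exact UnitarySix.eq_top_of_smul hbr𝔩 hirr𝔩 hι hιι hP' hQ' (by rw [hfinP', hr6]) ⟨3, by omega⟩ (by omega)
        (s := fun x y : U => s (x : W) y) (fun x y z => by simp only [Submodule.coe_add, hadd])
        (fun c x y => by simp only [Submodule.coe_smul, hsmul]) (fun x y => hsymm x y) hP'Q' hdefP' hdefQ' hadj𝔩
    by_cases hr8 : Module.finrank ℂ (LinearMap.range B') = 8
    · exact UnitaryEight.eq_top_of_smul hbr𝔩 hirr𝔩 hι hιι hP' hQ' (by rw [hfinP', hr8]) ⟨2, by omega⟩ (by omega)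
        (by omega) (s := fun x y : U => s (x : W) y) (fun x y z => by simp only [Submodule.coe_add, hadd])
        (fun c x y => by simp only [Submodule.coe_smul, hsmul]) (fun x y => hsymm x y) hP'Q' hdefP' hdefQ' hadj𝔩
    by_cases hr9 : Module.finrank ℂ (LinearMap.range B') = 9
    · exact UnitaryFourOdd.eq_top' hbr𝔩 hirr𝔩 hι hιι hP' hQ' ⟨4, by omega⟩ (by omega)
        (s := fun x y : U => s (x : W) y) (fun x y z => by simp only [Submodule.coe_add, hadd])
        (fun x y => hsymm x y) hP'Q' hdefP' hdefQ' hadj𝔩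
    · have hr10 : Module.finrank ℂ (LinearMap.range B') = 10 := by omega
      exact UnitaryThreeCoprime.eq_top' hbr𝔩 hirr𝔩 hι hιι hP' hQ' (by omega) (by omega)
        (s := fun x y : U => s (x : W) y) (fun x y z => by simp only [Submodule.coe_add, hadd])
        (fun x y => hsymm x y) hP'Q' hdefP' hdefQ' hadj𝔩

/-- **The `(12 | 13)` core** (one Euclid step onto `(12 | 1)`). [cite: Ribet1983, Thm. 3] [cite: Gordon1997, Thm. 6.3 (3)] -/
theorem UnitaryTwelve.eq_top_thirteen [FiniteDimensional ℂ W] {𝔊 : Submodule ℂ (Module.End ℂ W)}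
    (hbr : ∀ Y ∈ 𝔊, ∀ Z ∈ 𝔊, Y * Z - Z * Y ∈ 𝔊)
    (hirr : ∀ U : Submodule ℂ W, (∀ A ∈ 𝔊, ∀ u ∈ U, A u ∈ U) → U = ⊥ ∨ U = ⊤)
    {Θ : Module.End ℂ W} (hΘ : Θ ∈ 𝔊) (hΘΘ : Θ * Θ = 1)
    {P Q : Submodule ℂ W} (hP : ∀ x, x ∈ P ↔ Θ x = x) (hQ : ∀ x, x ∈ Q ↔ Θ x = -x)
    (hP12 : Module.finrank ℂ P = 12) (hQ13 : Module.finrank ℂ Q = 13)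
    {s : W → W → ℂ} (hadd : ∀ x y z, s (x + y) z = s x z + s y z)
    (hsmul : ∀ (c : ℂ) (x y : W), s (c • x) y = c * s x y) (hsymm : ∀ x y, s y x = starRingEnd ℂ (s x y))
    (hPQ : ∀ p ∈ P, ∀ q ∈ Q, s p q = 0) (hdefP : ∀ p ∈ P, s p p = 0 → p = 0) (hdefQ : ∀ q ∈ Q, s q q = 0 → q = 0)
    (hadj : ∀ X ∈ 𝔊, ∃ Y ∈ 𝔊, ∀ x y, s (X x) y = s x (Y y)) : 𝔊 = ⊤ := by
  refine UnitaryCoprimeStep.eq_top_of_onto_of_core hbr hirr hΘ hΘΘ hP hQ hP12 hQ13 (by norm_num) (by norm_num) hadd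
    hsymm hPQ hdefP hdefQ hadj ?_ ?_
  · exact UnitaryTwelve.exists_raise_onto_twelve_thirteen hbr hirr hΘ hΘΘ hP hQ hP12 hQ13 hadd hsmul hsymm hPQ hdefP
      hdefQ hadj
  · intro 𝔩 ι P' Q' hbr𝔩 hirr𝔩 hι hιι hP' hQ' hfinP' hfinQ' _ _ _ _
    exact UnitaryThreeCoprime.eq_top_of_finrank_eq_one hbr𝔩 hirr𝔩 hι hιι hP' hQ' (by rw [hfinP']; norm_num) (by omega)

/-- **The mirror `(13 | 12)`.** [cite: Ribet1983, Thm. 3] [cite: Gordon1997, Thm. 6.3 (3)] -/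
theorem UnitaryTwelve.eq_top_thirteen' [FiniteDimensional ℂ W] {𝔊 : Submodule ℂ (Module.End ℂ W)}
    (hbr : ∀ Y ∈ 𝔊, ∀ Z ∈ 𝔊, Y * Z - Z * Y ∈ 𝔊)
    (hirr : ∀ U : Submodule ℂ W, (∀ A ∈ 𝔊, ∀ u ∈ U, A u ∈ U) → U = ⊥ ∨ U = ⊤)
    {Θ : Module.End ℂ W} (hΘ : Θ ∈ 𝔊) (hΘΘ : Θ * Θ = 1)
    {P Q : Submodule ℂ W} (hP : ∀ x, x ∈ P ↔ Θ x = x) (hQ : ∀ x, x ∈ Q ↔ Θ x = -x)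
    (hP13 : Module.finrank ℂ P = 13) (hQ12 : Module.finrank ℂ Q = 12)
    {s : W → W → ℂ} (hadd : ∀ x y z, s (x + y) z = s x z + s y z)
    (hsmul : ∀ (c : ℂ) (x y : W), s (c • x) y = c * s x y) (hsymm : ∀ x y, s y x = starRingEnd ℂ (s x y))
    (hPQ : ∀ p ∈ P, ∀ q ∈ Q, s p q = 0) (hdefP : ∀ p ∈ P, s p p = 0 → p = 0) (hdefQ : ∀ q ∈ Q, s q q = 0 → q = 0)
    (hadj : ∀ X ∈ 𝔊, ∃ Y ∈ 𝔊, ∀ x y, s (X x) y = s x (Y y)) : 𝔊 = ⊤ := by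
  have hnΘ : -Θ ∈ 𝔊 := Submodule.neg_mem _ hΘ
  have hnΘΘ : (-Θ) * (-Θ) = 1 := by rw [neg_mul_neg, hΘΘ]
  exact UnitaryTwelve.eq_top_thirteen hbr hirr hnΘ hnΘΘ (P := Q) (Q := P)
    (fun x => by rw [hQ, LinearMap.neg_apply, neg_eq_iff_eq_neg]) (fun x => by rw [hP, LinearMap.neg_apply, neg_inj])
    hQ12 hP13 hadd hsmul hsymm (fun q hq p hp => by rw [hsymm, hPQ p hp q hq, map_zero]) hdefQ hdefP hadj

end Twelve

/-! ### §2 Multiplicities `(13, b)`, `13 ∤ b` — ALL of them -/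

section Thirteen

universe u

variable {W : Type u} [AddCommGroup W] [Module ℂ W]

/-- **The rank-thirteen raising lemma, every `dim Q ≥ 14` prime to `13`** (`dim P = 13`): ranks `2, …, 11 → +1` by the
Ψ-core route with the cores `(11|2), (10|3), (9|4), (8|5), (7|6), (6|7), (5|8), (4|9), (3|10), (2|11)`, rank
`12 → 13` by the triple route (`m (13 − ρ) = 12 ρ` forces `13 ∣ dim Q`).
[cite: Ribet1983, Thm. 3] [cite: Gordon1997, Thm. 6.3 (3)] [cite: Deligne1982HodgeCycles, I §3 Prop. 3.6] -/
theorem UnitaryThirteen.exists_raise_onto_thirteen_of_smul [FiniteDimensional ℂ W]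
    {𝔊 : Submodule ℂ (Module.End ℂ W)}
    (hbr : ∀ Y ∈ 𝔊, ∀ Z ∈ 𝔊, Y * Z - Z * Y ∈ 𝔊)
    (hirr : ∀ U : Submodule ℂ W, (∀ A ∈ 𝔊, ∀ u ∈ U, A u ∈ U) → U = ⊥ ∨ U = ⊤)
    {Θ : Module.End ℂ W} (hΘ : Θ ∈ 𝔊) (hΘΘ : Θ * Θ = 1)
    {P Q : Submodule ℂ W} (hP : ∀ x, x ∈ P ↔ Θ x = x) (hQ : ∀ x, x ∈ Q ↔ Θ x = -x)
    (hP13 : Module.finrank ℂ P = 13) (hQ14 : 14 ≤ Module.finrank ℂ Q) (hQ13 : ¬ 13 ∣ Module.finrank ℂ Q)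
    {s : W → W → ℂ} (hadd : ∀ x y z, s (x + y) z = s x z + s y z)
    (hsmul : ∀ (c : ℂ) (x y : W), s (c • x) y = c * s x y) (hsymm : ∀ x y, s y x = starRingEnd ℂ (s x y))
    (hPQ : ∀ p ∈ P, ∀ q ∈ Q, s p q = 0) (hdefP : ∀ p ∈ P, s p p = 0 → p = 0) (hdefQ : ∀ q ∈ Q, s q q = 0 → q = 0)
    (hadj : ∀ X ∈ 𝔊, ∃ Y ∈ 𝔊, ∀ x y, s (X x) y = s x (Y y)) :
    ∃ B ∈ 𝔊, Θ * B = B ∧ B * Θ = -B ∧ ∀ p ∈ P, ∃ w, B w = p := by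
  classical
  refine UnitaryLadder.exists_raise_onto_of_hup hbr hirr hΘ hΘΘ hP hQ hP13 (by norm_num) (by omega) ?_
  intro B' hB' hΘB' hB'Θ h2 h12
  by_cases hr12 : Module.finrank ℂ (LinearMap.range B') = 12
  · -- triple route: `m (13 − ρ) = 12 ρ` forces `13 ∣ dim Q`
    refine UnitaryRaisingRank.exists_raise_rank_gt_of_finrank_eq_succ_of_smul hbr hirr hΘ hΘΘ hP hQ hB' hΘB' hB'Θ
      (by omega) (by rw [hr12, hP13]) (by omega) (fun ρ hρ1 hρr => ?_) hadd hsmul hsymm hPQ hdefP hdefQ hadj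
    rw [hr12] at hρr ⊢
    interval_cases ρ <;> omega
  · -- Ψ-core route with the cores `(13 − r | r)`, `r = 2, …, 11`
    refine UnitaryRaisingRank.exists_raise_rank_gt_of_psi_core hbr hirr hΘ hΘΘ hP hQ hB' hΘB' hB'Θ (by omega)
      (by omega) (by omega) hadd hsymm hPQ hdefP hdefQ hadj fun U 𝔩 ι P' Q' hbr𝔩 hirr𝔩 hι hιι hP' hQ' hfinP' hfinQ'
        hP'Q' hdefP' hdefQ' hadj𝔩 => ?_
    rw [hP13] at hfinP'
    by_cases hr2 : Module.finrank ℂ (LinearMap.range B') = 2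
    · exact UnitaryTwoOdd.eq_top' hbr𝔩 hirr𝔩 hι hιι hP' hQ' ⟨5, by omega⟩ (by rw [hfinQ', hr2])
        (s := fun x y : U => s (x : W) y) (fun x y z => by simp only [Submodule.coe_add, hadd])
        (fun x y => hsymm x y) hP'Q' hdefP' hdefQ' hadj𝔩
    by_cases hr3 : Module.finrank ℂ (LinearMap.range B') = 3
    · exact UnitaryThreeCoprime.eq_top' hbr𝔩 hirr𝔩 hι hιι hP' hQ' (by omega) (by rw [hfinQ', hr3])
        (s := fun x y : U => s (x : W) y) (fun x y z => by simp only [Submodule.coe_add, hadd])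
        (fun x y => hsymm x y) hP'Q' hdefP' hdefQ' hadj𝔩
    by_cases hr4 : Module.finrank ℂ (LinearMap.range B') = 4
    · exact UnitaryFourOdd.eq_top' hbr𝔩 hirr𝔩 hι hιι hP' hQ' ⟨4, by omega⟩ (by rw [hfinQ', hr4])
        (s := fun x y : U => s (x : W) y) (fun x y z => by simp only [Submodule.coe_add, hadd])
        (fun x y => hsymm x y) hP'Q' hdefP' hdefQ' hadj𝔩
    by_cases hr5 : Module.finrank ℂ (LinearMap.range B') = 5
    · exact UnitaryFive.eq_top_of_smul' hbr𝔩 hirr𝔩 hι hιι hP' hQ' (by omega) (by rw [hfinQ', hr5])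
        (s := fun x y : U => s (x : W) y) (fun x y z => by simp only [Submodule.coe_add, hadd])
        (fun c x y => by simp only [Submodule.coe_smul, hsmul]) (fun x y => hsymm x y) hP'Q' hdefP' hdefQ' hadj𝔩
    by_cases hr6 : Module.finrank ℂ (LinearMap.range B') = 6
    · exact UnitarySeven.eq_top_of_smul hbr𝔩 hirr𝔩 hι hιι hP' hQ' (by omega) (by rw [hfinQ', hr6]; omega)
        (s := fun x y : U => s (x : W) y) (fun x y z => by simp only [Submodule.coe_add, hadd])
        (fun c x y => by simp only [Submodule.coe_smul, hsmul]) (fun x y => hsymm x y) hP'Q' hdefP' hdefQ' hadj𝔩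
    by_cases hr7 : Module.finrank ℂ (LinearMap.range B') = 7
    · exact UnitarySix.eq_top_of_smul hbr𝔩 hirr𝔩 hι hιι hP' hQ' (by omega) (by rw [hfinQ', hr7]; exact ⟨3, rfl⟩)
        (by rw [hfinQ', hr7]; omega)
        (s := fun x y : U => s (x : W) y) (fun x y z => by simp only [Submodule.coe_add, hadd])
        (fun c x y => by simp only [Submodule.coe_smul, hsmul]) (fun x y => hsymm x y) hP'Q' hdefP' hdefQ' hadj𝔩
    by_cases hr8 : Module.finrank ℂ (LinearMap.range B') = 8
    · exact UnitaryFive.eq_top_of_smul hbr𝔩 hirr𝔩 hι hιι hP' hQ' (by omega) (by rw [hfinQ', hr8]; omega)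
        (s := fun x y : U => s (x : W) y) (fun x y z => by simp only [Submodule.coe_add, hadd])
        (fun c x y => by simp only [Submodule.coe_smul, hsmul]) (fun x y => hsymm x y) hP'Q' hdefP' hdefQ' hadj𝔩
    by_cases hr9 : Module.finrank ℂ (LinearMap.range B') = 9
    · exact UnitaryFourOdd.eq_top hbr𝔩 hirr𝔩 hι hιι hP' hQ' (by omega) (by rw [hfinQ', hr9]; exact ⟨4, rfl⟩)
        (s := fun x y : U => s (x : W) y) (fun x y z => by simp only [Submodule.coe_add, hadd])
        (fun x y => hsymm x y) hP'Q' hdefP' hdefQ' hadj𝔩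
    by_cases hr10 : Module.finrank ℂ (LinearMap.range B') = 10
    · exact UnitaryThreeCoprime.eq_top hbr𝔩 hirr𝔩 hι hιι hP' hQ' (by omega) (by rw [hfinQ', hr10]; omega)
        (s := fun x y : U => s (x : W) y) (fun x y z => by simp only [Submodule.coe_add, hadd])
        (fun x y => hsymm x y) hP'Q' hdefP' hdefQ' hadj𝔩
    · have hr11 : Module.finrank ℂ (LinearMap.range B') = 11 := by omega
      exact UnitaryTwoOdd.eq_top hbr𝔩 hirr𝔩 hι hιι hP' hQ' (by omega) (by rw [hfinQ', hr11]; exact ⟨5, rfl⟩)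
        (s := fun x y : U => s (x : W) y) (fun x y z => by simp only [Submodule.coe_add, hadd])
        (fun x y => hsymm x y) hP'Q' hdefP' hdefQ' hadj𝔩

end Thirteen

section MainThirteen

variable {W : Type*} [AddCommGroup W] [Module ℂ W]

universe u in
/-- The induction behind `UnitaryThirteen.eq_top_of_smul` (strong induction on `b` with `13 ∤ b`; bases `b = 1, …, 12`
by the mirrored cores `(1|·), …, (11|·)` and `(13|12)` of §1; step `b → b − 13` by
`UnitaryCoprimeStep.eq_top_of_onto_of_core`). [cite: Ribet1983, Thm. 3] [cite: Gordon1997, §6 (proof of Thm. 6.3.3, pp. 18–19)] -/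
private theorem UnitaryThirteen.eq_top_of_smul_aux (b : ℕ) :
    ∀ {W : Type u} [AddCommGroup W] [Module ℂ W] [FiniteDimensional ℂ W]
      {𝔊 : Submodule ℂ (Module.End ℂ W)},
      (∀ Y ∈ 𝔊, ∀ Z ∈ 𝔊, Y * Z - Z * Y ∈ 𝔊) →
      (∀ U : Submodule ℂ W, (∀ A ∈ 𝔊, ∀ u ∈ U, A u ∈ U) → U = ⊥ ∨ U = ⊤) →
      ∀ {Θ : Module.End ℂ W}, Θ ∈ 𝔊 → Θ * Θ = 1 →
      ∀ {P Q : Submodule ℂ W}, (∀ x, x ∈ P ↔ Θ x = x) → (∀ x, x ∈ Q ↔ Θ x = -x) →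
      Module.finrank ℂ P = 13 → Module.finrank ℂ Q = b → ¬ 13 ∣ b →
      ∀ {s : W → W → ℂ}, (∀ x y z, s (x + y) z = s x z + s y z) →
      (∀ (c : ℂ) (x y : W), s (c • x) y = c * s x y) →
      (∀ x y, s y x = starRingEnd ℂ (s x y)) →
      (∀ p ∈ P, ∀ q ∈ Q, s p q = 0) → (∀ p ∈ P, s p p = 0 → p = 0) → (∀ q ∈ Q, s q q = 0 → q = 0) →
      (∀ X ∈ 𝔊, ∃ Y ∈ 𝔊, ∀ x y, s (X x) y = s x (Y y)) → 𝔊 = ⊤ := by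
  induction b using Nat.strong_induction_on with
  | _ b ih =>
  intro W _ _ _ 𝔊 hbr hirr Θ hΘ hΘΘ P Q hP hQ hP13 hQb hb13 s hadd hsmul hsymm hPQ hdefP hdefQ hadj
  have hb0 : b ≠ 0 := fun h => hb13 (by rw [h]; exact dvd_zero 13)
  by_cases hb1 : b = 1
  · exact UnitaryThreeCoprime.eq_top_of_finrank_eq_one hbr hirr hΘ hΘΘ hP hQ (by omega) (by rw [hQb, hb1])
  by_cases hb2 : b = 2
  · exact UnitaryTwoOdd.eq_top' hbr hirr hΘ hΘΘ hP hQ (by rw [hP13]; exact ⟨6, rfl⟩) (by rw [hQb, hb2]) hadd hsymm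
      hPQ hdefP hdefQ hadj
  by_cases hb3 : b = 3
  · exact UnitaryThreeCoprime.eq_top' hbr hirr hΘ hΘΘ hP hQ (by rw [hP13]; decide) (by rw [hQb, hb3]) hadd hsymm hPQ
      hdefP hdefQ hadj
  by_cases hb4 : b = 4
  · exact UnitaryFourOdd.eq_top' hbr hirr hΘ hΘΘ hP hQ (by rw [hP13]; exact ⟨6, rfl⟩) (by rw [hQb, hb4]) hadd hsymm
      hPQ hdefP hdefQ hadj
  by_cases hb5 : b = 5
  · exact UnitaryFive.eq_top_of_smul' hbr hirr hΘ hΘΘ hP hQ (by rw [hP13]; decide) (by rw [hQb, hb5]) hadd hsmul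
      hsymm hPQ hdefP hdefQ hadj
  by_cases hb6 : b = 6
  · exact UnitarySix.eq_top_of_smul' hbr hirr hΘ hΘΘ hP hQ (by rw [hP13]; exact ⟨6, rfl⟩) (by rw [hP13]; decide)
      (by rw [hQb, hb6]) hadd hsmul hsymm hPQ hdefP hdefQ hadj
  by_cases hb7 : b = 7
  · exact UnitarySeven.eq_top_of_smul' hbr hirr hΘ hΘΘ hP hQ (by rw [hP13]; decide) (by rw [hQb, hb7]) hadd hsmul
      hsymm hPQ hdefP hdefQ hadj
  by_cases hb8 : b = 8
  · exact UnitaryEight.eq_top_of_smul' hbr hirr hΘ hΘΘ hP hQ (by rw [hP13]; exact ⟨6, rfl⟩) (by omega) (by omega)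
      (by rw [hQb, hb8]) hadd hsmul hsymm hPQ hdefP hdefQ hadj
  by_cases hb9 : b = 9
  · exact UnitaryNine.eq_top_of_smul' hbr hirr hΘ hΘΘ hP hQ (by omega) (by rw [hP13]; decide) (by omega) (by omega)
      (by rw [hQb, hb9]) hadd hsmul hsymm hPQ hdefP hdefQ hadj
  by_cases hb10 : b = 10
  · exact UnitaryTen.eq_top_of_smul' hbr hirr hΘ hΘΘ hP hQ (by rw [hP13]; exact ⟨6, rfl⟩) (by rw [hP13]; decide)
      (by omega) (by omega) (by rw [hQb, hb10]) hadd hsmul hsymm hPQ hdefP hdefQ hadj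
  by_cases hb11 : b = 11
  · exact UnitaryEleven.eq_top_of_smul' hbr hirr hΘ hΘΘ hP hQ (by rw [hP13]; decide) (by rw [hQb, hb11]) hadd hsmul
      hsymm hPQ hdefP hdefQ hadj
  by_cases hb12 : b = 12
  · exact UnitaryTwelve.eq_top_thirteen' hbr hirr hΘ hΘΘ hP hQ hP13 (by rw [hQb, hb12]) hadd hsmul hsymm hPQ hdefP
      hdefQ hadj
  have hb14 : 14 ≤ b := by omega
  refine UnitaryCoprimeStep.eq_top_of_onto_of_core hbr hirr hΘ hΘΘ hP hQ hP13 hQb (by norm_num) (by omega) hadd hsymm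
    hPQ hdefP hdefQ hadj ?_ ?_
  · exact UnitaryThirteen.exists_raise_onto_thirteen_of_smul hbr hirr hΘ hΘΘ hP hQ hP13 (by rw [hQb]; exact hb14)
      (by rw [hQb]; exact hb13) hadd hsmul hsymm hPQ hdefP hdefQ hadj
  · intro 𝔩 ι P' Q' hbr𝔩 hirr𝔩 hι hιι hP' hQ' hfinP' hfinQ' hP'Q' hdefP' hdefQ' hadj𝔩
    exact ih (b - 13) (by omega) hbr𝔩 hirr𝔩 hι hιι hP' hQ' hfinP' hfinQ' (fun h => hb13 (by omega))
      (s := fun x y : Q => s (x : W) y) (fun x y z => by simp only [Submodule.coe_add, hadd])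
      (fun c x y => by simp only [Submodule.coe_smul, hsmul]) (fun x y => hsymm x y) hP'Q' hdefP' hdefQ' hadj𝔩

/-- **THE `Θ`-SUBALGEBRA THEOREM FOR UNITARY MULTIPLICITIES `(13, b)`, EVERY `b` PRIME TO `13`** (Ribet's Thm. 3 at
`(13, n″)`, `13 ∤ n″`, classification-free; NEW beyond the tree's `(13, ≤ 12)`: `b = 14, 15, 16, …`).
[cite: Ribet1983, Thm. 3] [cite: Gordon1997, Thm. 6.3 (3) and pp. 18–19] [cite: Deligne1982HodgeCycles, I §3 Prop. 3.4, 3.6] -/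
theorem UnitaryThirteen.eq_top_of_smul [FiniteDimensional ℂ W] {𝔊 : Submodule ℂ (Module.End ℂ W)}
    (hbr : ∀ Y ∈ 𝔊, ∀ Z ∈ 𝔊, Y * Z - Z * Y ∈ 𝔊)
    (hirr : ∀ U : Submodule ℂ W, (∀ A ∈ 𝔊, ∀ u ∈ U, A u ∈ U) → U = ⊥ ∨ U = ⊤)
    {Θ : Module.End ℂ W} (hΘ : Θ ∈ 𝔊) (hΘΘ : Θ * Θ = 1)
    {P Q : Submodule ℂ W} (hP : ∀ x, x ∈ P ↔ Θ x = x) (hQ : ∀ x, x ∈ Q ↔ Θ x = -x)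
    (hP13 : Module.finrank ℂ P = 13) (hQ13 : ¬ 13 ∣ Module.finrank ℂ Q)
    {s : W → W → ℂ} (hadd : ∀ x y z, s (x + y) z = s x z + s y z)
    (hsmul : ∀ (c : ℂ) (x y : W), s (c • x) y = c * s x y) (hsymm : ∀ x y, s y x = starRingEnd ℂ (s x y))
    (hPQ : ∀ p ∈ P, ∀ q ∈ Q, s p q = 0) (hdefP : ∀ p ∈ P, s p p = 0 → p = 0) (hdefQ : ∀ q ∈ Q, s q q = 0 → q = 0)
    (hadj : ∀ X ∈ 𝔊, ∃ Y ∈ 𝔊, ∀ x y, s (X x) y = s x (Y y)) : 𝔊 = ⊤ :=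
  UnitaryThirteen.eq_top_of_smul_aux _ hbr hirr hΘ hΘΘ hP hQ hP13 rfl hQ13 hadd hsmul hsymm hPQ hdefP hdefQ hadj

/-- **The mirror `(b | 13)`, `13 ∤ b`** (apply `eq_top_of_smul` to `−Θ`). [cite: Ribet1983, Thm. 3]
[cite: Gordon1997, Thm. 6.3 (3)] -/
theorem UnitaryThirteen.eq_top_of_smul' [FiniteDimensional ℂ W] {𝔊 : Submodule ℂ (Module.End ℂ W)}
    (hbr : ∀ Y ∈ 𝔊, ∀ Z ∈ 𝔊, Y * Z - Z * Y ∈ 𝔊)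
    (hirr : ∀ U : Submodule ℂ W, (∀ A ∈ 𝔊, ∀ u ∈ U, A u ∈ U) → U = ⊥ ∨ U = ⊤)
    {Θ : Module.End ℂ W} (hΘ : Θ ∈ 𝔊) (hΘΘ : Θ * Θ = 1)
    {P Q : Submodule ℂ W} (hP : ∀ x, x ∈ P ↔ Θ x = x) (hQ : ∀ x, x ∈ Q ↔ Θ x = -x)
    (hP13 : ¬ 13 ∣ Module.finrank ℂ P) (hQ13 : Module.finrank ℂ Q = 13)
    {s : W → W → ℂ} (hadd : ∀ x y z, s (x + y) z = s x z + s y z)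
    (hsmul : ∀ (c : ℂ) (x y : W), s (c • x) y = c * s x y) (hsymm : ∀ x y, s y x = starRingEnd ℂ (s x y))
    (hPQ : ∀ p ∈ P, ∀ q ∈ Q, s p q = 0) (hdefP : ∀ p ∈ P, s p p = 0 → p = 0) (hdefQ : ∀ q ∈ Q, s q q = 0 → q = 0)
    (hadj : ∀ X ∈ 𝔊, ∃ Y ∈ 𝔊, ∀ x y, s (X x) y = s x (Y y)) : 𝔊 = ⊤ := by
  have hnΘ : -Θ ∈ 𝔊 := Submodule.neg_mem _ hΘ
  have hnΘΘ : (-Θ) * (-Θ) = 1 := by rw [neg_mul_neg, hΘΘ]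
  exact UnitaryThirteen.eq_top_of_smul hbr hirr hnΘ hnΘΘ (P := Q) (Q := P)
    (fun x => by rw [hQ, LinearMap.neg_apply, neg_eq_iff_eq_neg]) (fun x => by rw [hP, LinearMap.neg_apply, neg_inj])
    hQ13 hP13 hadd hsmul hsymm (fun q hq p hp => by rw [hsymm, hPQ p hp q hq, map_zero]) hdefQ hdefP hadj

end MainThirteen

end HodgeStructure

end Literature.AlgebraicGeometry.Motives

end
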